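import Summits.QuantumFields.YangMills.Theorems.BalabanUVNodesN12MinimiserFamilyKnitRowThm1NamedFactsOnZOfRecord
import Literature.MathematicalPhysics.QuantumFieldTheory.Balaban1983to89.B15Prop1MinimiserClassAtDatumScale
import HarnessLib

/-!
# BalabanUVNodes ∕ N12 — THE (J0′) HEAD OF RECORD IN TWO-RADII FORM, MINIMALITY READ AT THE DATUM SCALE, THE RADIUS ANNOUNCED BEFORE THE DATA BUDGET
# ([Balaban1985Variational] Thm 1 (6)–(8) pp.278–279; [Balaban1989LargeFieldI] (1.74) p.192, p.193, Prop. 1 p.194 «for ε > 0 sufficiently small»; [Balaban1989LargeFieldII] p.357,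
# (1.7)–(1.9) p.358; [Balaban1988Convergent] (2.12)–(2.13) pp.256–257)

Cell `pub-ymgap` (HUMAN RULINGS D-0062 ∕ D-0149), lane `pub-ymgap-dag-n12-c` g31 (R134 seat (a), N12 = [B15], s1, LANE OWNER); count-neutral helper of K1⁹ `stmt-QuantumFields-27364`
(`--kind proof --supports … --as helper`).  THEOREMS ONLY (0 `def`, 0 `instance`, 0 `sorry`); ONE composition by name.

WHY (dag-n12-d g27 ⚑ LOCATED «(J0′) × DIRECT: RADIUS COUPLING», kernel certificate ✓p744117 `…N12DirectWindowRadiusFloor`; lane ruling «ROAD (B) (8)-FLOOR», pub-ymgap INBOX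
2026-08-29T21:24Z).  The (J0′) head of record ✓p740879 `…KnitRowThm1NamedFactsOnZOfRecord.exists_R_hMinRow_of_variationalThm1NamedFacts_alongOrbit_onZ_ofRecord` announces its radius
`R` AFTER the guard `eR` and asks the family's real points to minimise over the class at the record's tolerance `εr`; the direct socket v12 T4 ✓p738673 reads `R` in its threshold
(`∝ R²`) and puts a floor `∝ εreg` under it — EMPTY as composed (R = O(εr)).  THIS FILE re-issues the head so that the two objects compose under the lane's ruling: the head's own
`eR` becomes the guard CAP `eG` (every displayed row of ✓p740879 is an UPPER bound on it), its radius `R` is announced, and THEN — for every DATA budget `0 < eR ≤ eG`, every class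
tolerance `e ∈ [2B₃(c_E+1)eR, εr]` and every base field of the strict guard at `eR` — the (J0′) body holds in TWO-RADII form: clauses 1–2 (entrywise holomorphic, bounded by `4𝓐₀`) on
`ball 0 R` VERBATIM (what the (K) row's Cauchy estimate reads), clause 3 (real points are minimisers) on the smaller real ball `min R (eR∕8)` with MEMBERSHIP in the class at
`2B₃(c_E+1)eR` and MINIMALITY over the class at `e` (what the chart half and the class-reading producers — (σ)_W window gauge, plaquette letters, proxies — read, now at the DATUM
scale).  So a consumer fixes `R` first and then chooses the data budget `eR` below the window bound `C₁·2B₃(c_E+1)eR + m′ρn ≤ Thr(R)`: Prop. 1's own «∃ e0 > 0, ∀ ε ≤ e0» per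
instance ([IV] p.194; `B15Prop1Carrier.prop1Printed_lfVarOn_iff`).

  ★★★★ `exists_R_hMinRowTwoRadii_atDatumScale_of_variationalThm1NamedFacts_alongOrbit_onZ_ofRecord`: ✓p740879's binders VERBATIM (its `eR` = the cap `eG`); conclusion
  `∃ R > 0, ∀ eR ∈ (0, eG], ∀ e ∈ [B₃·2(c_E+1)eR, εr], ∀ V_k` in the strict guard at `eR`, the two-radii body.  Proof = ✓p740879 ∘ guard restriction ∘ the lane's junction kit
  `B15Prop1MinimiserClassAtDatumScale.hMin_twoRadii_withEps_of_hMin` at `ν⟨εreg := εr⟩` (its (8)-letter by dag-n12-d's `thm1TorusClass_of_variationalThm1RegSepCoP7M` at that tolerance).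

«INHABITED BY» (director-ym №300∕№303): `h15`, `h15EU` — OPEN exactly as in ✓p740879 (K0⁷'s item; the (E∕U) producer item); every other displayed row is ✓p740879's, jointly
inhabited as read there.

HONEST FRAMING ∕ LOCATED.  One composition by name; BOTH [15] facts are HYPOTHESES (named, never asserted); nothing of Bałaban's asserted; `δ₀`, `R`, `ρ″`, `εH` = EXISTENCE constants
per (instance, height) (census U4); scope = print's box scope; N12 NOT discharged; K0⁷ ∕ K1⁹ NOT closed; counts unmoved; one finite 𝕋⁴ programme at fixed `ε = L^{-K}` — R4 closes only
the conditional rung `BalabanLadder.UV`; no summit statement is proved here and NOT the Yang–Mills mass gap (Clay); nothing continuum ∕ ℝ⁴ ∕ OS.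
-/

noncomputable section

namespace Summit.QuantumFields.YangMills.BalabanUVNodes.N12MinimiserFamilyKnitRowTwoRadiiAtDatumScaleOnZOfRecord

open scoped BigOperators Matrix.Norms.L2Operator Topology
open Literature.MathematicalPhysics.QuantumFieldTheory.Balaban1983to89
open T4Continuum
open B15DeterminingSets GaugeField
open ExpMeanLog (deltaSU)
open B15Prop1AnalyticExtClause (cplxVec)
open B15Prop1ChartCalculusSU2 (E3)
open T4CubeChartGnomonic (SU2)
open B14.Eq213DetSet (Bj maxDomT)
open B14.Eq213MaximalDomains (side)
open B14.Eq22Determines (IsBlockUnion)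
open T4AxialGaugeSmallField (boxPlaqs castSite boxBonds)
open B15Prop1Carrier (plaqsInside)
open Literature.MathematicalPhysics.QuantumFieldTheory.BalabanImbrieJaffe1984to88.BIJ85Eq453GaugeField (qsstarGIter0)
open B15ShellGauge193 (shellGauge)
open B15Extension193 (extend)
open B16Sect1Backgrounds (toMS expMul)
open B15Prop1ChartSU2 (su2Chart)
open Metric (ball)
open Summit.QuantumFields.YangMills.BalabanUVNodes.N12MinimiserFamilyKnitRowThm1NamedFactsOnZOfRecord (exists_R_hMinRow_of_variationalThm1NamedFacts_alongOrbit_onZ_ofRecord)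
open Summit.QuantumFields.YangMills.BalabanUVNodes.N12AtRecord13Prop1KnitThm1OfRecord (thm1TorusClass_of_variationalThm1RegSepCoP7M)
open B15Prop1MinimiserClassAtDatumScale (hMin_twoRadii_withEps_of_hMin)

variable {F : T4Family} {k : ℕ}

/-- ★★★★ **THE (J0′) HEAD OF RECORD IN TWO-RADII FORM, MINIMALITY AT THE DATUM SCALE, `R` ANNOUNCED BEFORE THE DATA BUDGET** — ✓p740879's
`exists_R_hMinRow_of_variationalThm1NamedFacts_alongOrbit_onZ_ofRecord` with every binder VERBATIM (its guard `eR` read as the CAP `eG`), and the conclusion re-issued: `∃ R > 0` and then,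
for every data budget `0 < eR ≤ eG`, every tolerance `e` with `B₃·2(c_E+1)eR ≤ e ≤ εr`, and every base field `V_k` with `|V_k(∂p′) − 1| < eR` inside `(Z ∩ Λᶜ)^{(k)}`: a family `Ũ`
entrywise holomorphic on `ball 0 R` and bounded by `4𝓐₀` there (UNCHANGED), whose real points `(p, B′)` with `‖p‖, ‖B′‖ < min R (eR∕8)` are configurations `U′` lying in the class
`U_k({Ω_j(Z)}, 2B₃(c_E+1)eR)` and MINIMISING the Wilson action over `U_k({Ω_j(Z)}, e)` with the perturbed (1.74) data.  The radius does not depend on the data budget: the lane's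
answer to (r1) of the located coupling. [cite: Balaban1985Variational, (2),(6),(7) p.278, Thm 1 (8) p.279; Balaban1989LargeFieldI, (i) p.177, (1.74) p.192, p.193 L14–20, Prop. 1 (1.77)–(1.78) p.194; Balaban1988Convergent, (2.1) p.254, p.255, (2.12)–(2.13) pp.256–257, (2.18) p.257; Balaban1989LargeFieldII, p.357, (1.7)–(1.9) p.358, (1.12)–(1.13) p.359; Balaban1985RegularSpaces, (1.3)–(1.9) p.77] -/
theorem exists_R_hMinRowTwoRadii_atDatumScale_of_variationalThm1NamedFacts_alongOrbit_onZ_ofRecord (ν : Node00.Stage7Numerics) (Kt : ℕ) (hd3 : 3 ≤ (F.P Kt).d)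
    (Z : Set (Site (F.P Kt) 0)) (hkK : k + 1 ≤ (F.P Kt).m + (F.P Kt).K) (hk1 : 1 ≤ k) (hdiv : side (F.P Kt).L ν.M₁ k ∣ (F.P Kt).sitesPerDir 0)
    (hfloor : ((F.P Kt).d + 14) * (F.P Kt).L ≤ ν.M₁) (hZblk : IsBlockUnion k Z)
    {c : ℕ} (hkc : k + c ≤ (F.P Kt).m + (F.P Kt).K) (hc : 4 * (F.P Kt).d + (3 * ((F.P Kt).d * (((F.P Kt).L - 1) / 2)) + 5) + 3 < 2 * (F.P Kt).L ^ c)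
    (hMrad : (4 * (F.P Kt).d + (3 * ((F.P Kt).d * (((F.P Kt).L - 1) / 2)) + 5)) * (F.P Kt).L ^ 2 + 2 * (F.P Kt).d * (F.P Kt).L + 12 ≤ ν.M₁)
    (hM₁ : (((F.P Kt).d + 4) * (F.P Kt).L + 6) * (F.P Kt).L ^ 2 ≤ ν.M₁)
    {B₃ a₀ a₁ : ℝ} (h15 : Node00.VariationalThm1RegSepCoP7M F 2 B₃ a₀ a₁) (h15EU : B11Thm1ExistsUniqueCoP7M.VariationalThm1EUSepCoP7M F 2 B₃ a₀ a₁) :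
    ∃ ρ'' εH : ℝ, 0 < ρ'' ∧ 0 < εH ∧
    ∃ δ₀ : ℝ, 0 < δ₀ ∧
    ∀ (Λ : Set (Site (F.P Kt) 0)) (lo hi : Fin (F.P Kt).d → ℤ) (eG : ℝ), 0 < eG →
    ∀ (n : ℕ), (∀ κ, hi κ ≤ lo κ + n) → (∀ κ, ((hi κ - lo κ + 1).toNat : ℤ) + 5 < ((F.P Kt).sitesPerDir k : ℤ)) → lo ≤ hi →
      pts k Λ = (castSite '' Set.Icc lo hi : Set (Site (F.P Kt) k)) → (boxPlaqs (lo - 1) (hi + 1) : Set (Plaq (F.P Kt) k)) ⊆ plaqsInside (pts k Z) →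
    ∀ (LO HI : Fin (F.P Kt).d → ℤ) (n' : ℕ), LO ≤ lo - 1 → hi + 1 ≤ HI → (∀ κ, HI κ ≤ LO κ + n') → n' < (F.P Kt).sitesPerDir k →
      (boxPlaqs LO HI : Set (Plaq (F.P Kt) k)) ⊆ plaqsInside (pts k Z) → {e : PBond (F.P Kt) k | e.src ∈ pts k Z ∧ e.tgt ∈ pts k Z} ⊆ boxBonds LO HI →
    ∀ {cE : ℝ}, 12 * ((F.P Kt).d : ℝ) * ((n : ℝ) + 2) ^ 2 ≤ cE → 6 * ((((F.P Kt).d - 1 : ℕ)) : ℝ) * (F.P Kt).L ^ k * (2 * ((cE + 1) * eG)) ≤ ρ'' →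
    ∀ (ext : GaugeField (F.P Kt) k SU2 → GaugeField (F.P Kt) k SU2), (∀ W, ext W = extend (pts k Λ) (shellGauge W lo hi) W) →
    ∀ {𝓐₀ : ℝ}, 1 < 𝓐₀ →
    ∀ (εr : ℝ), 0 < εr → 12 * ((((F.P Kt).d - 1 : ℕ)) : ℝ) * (F.P Kt).L * εr ≤ ρ'' → εr ≤ εH →
      (143 * (((((F.P Kt).d + 4 : ℕ) : ℝ)) ^ 2 / 4) ^ 2) * (2 * ((F.P Kt).L : ℝ) ^ 2 * εr) ≤ 1 / 3 →
      2 * (2 * ((F.P Kt).L : ℝ) ^ 2 * εr) ≤ 2 * deltaSU (Fin 2) / ((((F.P Kt).d + 4) * (F.P Kt).L : ℕ) : ℝ) ^ 2 →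
    ∀ {ε₀ : ℝ}, (cE + 1) * (2 * eG) ≤ a₁ → B₃ * ((cE + 1) * (2 * eG)) ≤ εr → εr < ε₀ → ε₀ ≤ a₀ →
    ∀ {ρn : ℝ}, 0 ≤ ρn →
    (max ρn ((((2 * (∑ i ∈ Finset.range (k + 1), ((F.P Kt).d * (((F.P Kt).L ^ i - 1) / 2) + 1)) + 1 +
                  (3 * ((F.P Kt).d * (((F.P Kt).L - 1) / 2)) + 5) * (F.P Kt).L ^ k : ℕ) : ℝ)) ^ 2 / 4 * (εr * (F.P Kt).eta 0 ^ 2) +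
                ((3 * ((F.P Kt).d * (((F.P Kt).L - 1) / 2)) + 5 : ℕ) : ℝ) * (6 * ((((((F.P Kt).d + 2) * (F.P Kt).L : ℕ) : ℝ) ^ 2 / 4) * (2 * (εr * (F.P Kt).L ^ 2))) * ∑ i ∈ Finset.range k, ((F.P Kt).L : ℝ) ^ i) + ((3 * ((F.P Kt).d * (((F.P Kt).L - 1) / 2)) + 5 : ℕ) : ℝ) * ρn) ≤ δ₀) →
    (((F.P Kt).d : ℝ) * n' + 1) * ((((F.P Kt).d - 1 : ℕ) : ℝ) * n' * ((12 * (F.P Kt).d * (n + 2) ^ 2 + 1) * eG) + 3 * (F.P Kt).d * (n + 2) ^ 2 * eG) ≤ ρn →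
    -- THE RADIUS FIRST; THEN every data budget `eR ≤ eG`, every class tolerance `e ∈ [2B₃(c_E+1)eR, εr]`, every base field of the strict guard at `eR`
    ∃ R : ℝ, 0 < R ∧ ∀ (eR : ℝ), 0 < eR → eR ≤ eG → ∀ (e : ℝ), B₃ * (2 * ((cE + 1) * eR)) ≤ e → e ≤ εr →
      ∀ Vk : GaugeField (F.P Kt) k SU2, PlaqSmallOn (plaqsInside (pts k (Z ∩ Λᶜ))) eR Vk →
      ∃ Ũ : VecField (F.P Kt) k (EuclideanSpace ℂ (Fin 3)) × VecField (F.P Kt) k (EuclideanSpace ℂ (Fin 3)) → PBond (F.P Kt) 0 → Matrix (Fin 2) (Fin 2) ℂ,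
        (∀ b i j, DifferentiableOn ℂ (fun z => Ũ z b i j) (ball 0 R)) ∧
        (∀ z ∈ ball (0 : VecField (F.P Kt) k (EuclideanSpace ℂ (Fin 3)) × VecField (F.P Kt) k (EuclideanSpace ℂ (Fin 3))) R, ∀ b i j, ‖Ũ z b i j‖ ≤ 4 * 𝓐₀) ∧
        ∀ p B' : VecField (F.P Kt) k E3, ‖p‖ < min R (eR / 8) → ‖B'‖ < min R (eR / 8) → ∃ U' : GaugeField (F.P Kt) 0 SU2,
          (∀ b, Ũ (cplxVec p, cplxVec B') b = ((U' b : SU2) : Matrix (Fin 2) (Fin 2) ℂ)) ∧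
            U' ∈ Node00.regMSCoPOfRecord F 2 {ν with εreg := B₃ * (2 * ((cE + 1) * eR))} Kt k (maxDomT ν.M₁ Z) ∧
            IsMinimizer (Node00.avOfRecord F 2 Kt) (Node00.regMSCoPOfRecord F 2 {ν with εreg := e} Kt k (maxDomT ν.M₁ Z)) (Bj ν.M₁ Z k)
              (avgFamily (Node00.avOfRecord F 2 Kt) (qsstarGIter0 k (expMul su2Chart B' (ext (expMul su2Chart p Vk))))) U' := by
  obtain ⟨ρ'', εH, hρ'', hεH, δ₀, hδ₀, hall⟩ :=
    exists_R_hMinRow_of_variationalThm1NamedFacts_alongOrbit_onZ_ofRecord ν Kt hd3 Z hkK hk1 hdiv hfloor hZblk hkc hc hMrad hM₁ h15 h15EU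
  refine ⟨ρ'', εH, hρ'', hεH, δ₀, hδ₀, ?_⟩
  intro Λ lo hi eG heG n hn hN5 hlohi hbox hZ LO HI n' hLO hHI hn' hn'N hR' hZbox cE hcE hδρ ext hext 𝓐₀ h𝓐₀ εr hεr hερ hεH' hα3 hα2 ε₀ ha₁ hB₃ hr₀ ha₀ ρn hρn hT hnorm
  obtain ⟨R, hR, hbody⟩ := hall Λ lo hi eG heG n hn hN5 hlohi hbox hZ LO HI n' hLO hHI hn' hn'N hR' hZbox hcE hδρ ext hext h𝓐₀ εr hεr hερ hεH' hα3 hα2 ha₁ hB₃ hr₀ ha₀ hρn hT hnorm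
  refine ⟨R, hR, fun eR heR heRG e he heε Vk hVk => ?_⟩
  -- the head at the cap serves the smaller guard
  have hVkG : PlaqSmallOn (plaqsInside (pts k (Z ∩ Λᶜ))) eG Vk := fun q hq => lt_of_lt_of_le (hVk q hq) heRG
  have hMin := hbody Vk hVkG
  -- geometry ∕ numerics rows of the kit
  have hN3 : ∀ κ, hi κ - lo κ + 3 < ((F.P Kt).sitesPerDir k : ℤ) := fun κ => by
    have h5 := hN5 κ
    have hle : lo κ ≤ hi κ := hlohi κ
    rw [Int.toNat_of_nonneg (by linarith)] at h5
    linarith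
  have hM2 : 2 ≤ ν.M₁ := by
    have hL : 1 ≤ (F.P Kt).L := (F.P Kt).L_pos
    have h1 : ((F.P Kt).d + 14) * 1 ≤ ((F.P Kt).d + 14) * (F.P Kt).L := Nat.mul_le_mul_left _ hL
    omega
  have hcE0 : 0 ≤ cE := le_trans (by positivity) hcE
  have ha₁' : 2 * ((cE + 1) * eR) ≤ a₁ := by nlinarith
  have ha₀' : ({ν with εreg := εr} : Node00.Stage7Numerics).εreg ≤ a₀ := by
    show εr ≤ a₀
    linarith
  -- the kit at the tolerance `εr` (the (8)-letter at `ν⟨εreg := εr⟩` by dag-n12-d's junction; `M₁` unchanged)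
  exact hMin_twoRadii_withEps_of_hMin (F := F) {ν with εreg := εr} Kt hd3 Z Λ hk1 (by omega) lo hi n hn hlohi hbox hZ hN3 ext hext hZblk hM2 hdiv hcE
    (thm1TorusClass_of_variationalThm1RegSepCoP7M {ν with εreg := εr} Kt h15) heR ha₁' he heε ha₀' Vk hVk hMin

end Summit.QuantumFields.YangMills.BalabanUVNodes.N12MinimiserFamilyKnitRowTwoRadiiAtDatumScaleOnZOfRecord

end
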